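import Literature.Probability.Percolation.CornerPercolation
import Summits.CriticalPhenomena.CardyFormulaZ2.Theorems.ModulusResponseBondIdentification

/-!
# Route ModulusResponse — crux `SegmentRSW` (item stmt-CriticalPhenomena-6470), stub `stub_cellLaw`

**The cell law is the point reflection of the corner model.** For `u ∈ [0, 1/2]` the cell
measure `μ_u` of the route — the push-forward of `setBer(univ, 1/2) ⊗ setBer(univ, u)` under the
cell map which opens, at every vertex `m` of `ℤ²`, the LEFT edge `s(m - e₀, m)` iff `m ∈ X` and the
DOWN edge `s(m - e₁, m)` iff `(m ∈ X ↔ m ∉ D)` — equals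
`(cornerPercolation ⟨2u⟩).map (relabel (x ↦ -x))`, the point reflection of the corner model
`M_{2u}` of `Literature/Probability/Percolation/CornerPercolation.lean` (EAST edge of `v` open iff
the fair coin `(v, 0) ∈ S`, NORTH edge iff `((v, 0) ∈ S ↔ (v, 1) ∉ S)`, splitting bit
`(v, 1) ~ Ber(t/2)`).

Proof (product-measure transport, the pattern of `ModulusResponseBondIdentification.lean`; no
auxiliary definitions — every gadget is an explicit lambda):

* the two layers `({i | (i, 0) ∈ S}, {i | (i, 1) ∈ S})` of a `prodBernoulli P` sample on
  `ι × {0, 1}` form a pair of independent `prodBernoulli` samples (`prodBernoulli_map_layers`: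
  `Measure.map_infinitePi_infinitePi_of_inj` along `Prod.swap`, `Measure.infinitePi_map_curry`,
  `Measure.infinitePi_map_eval_prod`, `Measure.map_prod_map`); for `P = cornerParam t` the layers
  are `setBer(univ, 1/2)` and `setBer(univ, half * t)`, and `half * ⟨2u⟩ = ⟨u⟩`;
* reindexing the vertices by `v ↦ -v` preserves `prodBernoulli (cornerParam t)`
  (`prodBernoulli_cornerParam_map_vertexReindex`);
* pointwise, the reflected corner configuration of `S` is the cell configuration of the reflected
  layers (`relabel_neg_cornerConfig`): the east/north edge `s(v, v + e_j)` of `v = -m` reflects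
  to the left/down edge `s(m - e_j, m)` of `m`.
-/

noncomputable section

namespace Summit.CriticalPhenomena.CardyFormulaZ2.Cruxes.SegmentRSW.Birth

/-! ### Transport lemmas -/

namespace CellLaw

open MeasureTheory Measure ProbabilityTheory unitInterval
open Literature.Probability.Percolation Literature.Probability.LatticeModels

/-- Reading off the two layers `({i | (i, 0) ∈ S}, {i | (i, 1) ∈ S})` of a configuration on
`ι × {0, 1}` is measurable. [folklore] -/
theorem measurable_layers {ι : Type*} :
    Measurable (fun S : Set (ι × Fin 2) =>
      ({i | (i, (0 : Fin 2)) ∈ S}, {i | (i, (1 : Fin 2)) ∈ S})) := by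
  refine Measurable.prodMk ?_ ?_
  · exact measurable_set_iff.2 fun i => measurable_set_mem _
  · exact measurable_set_iff.2 fun i => measurable_set_mem _

/-- **The two layers of a product Bernoulli configuration on `ι × {0, 1}` are independent
product Bernoulli configurations**: under `prodBernoulli P` the pair
`({i | (i, 0) ∈ S}, {i | (i, 1) ∈ S})` has law `prodBernoulli (P (·, 0)) ⊗ prodBernoulli (P (·, 1))`
(reindex the coins by `{0, 1} × ι`, curry, and evaluate the outer product at its two distinct
coordinates). [folklore] -/
theorem prodBernoulli_map_layers {ι : Type*} (P : ι × Fin 2 → unitInterval) :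
    (prodBernoulli P).map (fun S : Set (ι × Fin 2) =>
        ({i | (i, (0 : Fin 2)) ∈ S}, {i | (i, (1 : Fin 2)) ∈ S})) =
      (prodBernoulli fun i => P (i, 0)).prod (prodBernoulli fun i => P (i, 1)) := by
  have hset : Measurable (fun q : ι → Prop => {i | q i}) := measurable_setOf
  have hev : Measurable fun F : Fin 2 → ι → Prop => (F 0, F 1) :=
    (measurable_pi_apply 0).prodMk (measurable_pi_apply 1)
  have hsw : Measurable fun (ω : ι × Fin 2 → Prop) (k : Fin 2 × ι) => ω k.swap :=
    measurable_pi_lambda _ fun k => measurable_pi_apply _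
  have hcur : Measurable (MeasurableEquiv.curry (Fin 2) ι Prop) := MeasurableEquiv.measurable _
  -- (1) reindex the coins by `Fin 2 × ι`
  have h1 : (infinitePi fun k : ι × Fin 2 =>
      (toNNReal (P k) • dirac True + toNNReal (σ (P k)) • dirac False : Measure Prop)).map
        (fun (ω : ι × Fin 2 → Prop) (k : Fin 2 × ι) => ω k.swap) =
      infinitePi fun k : Fin 2 × ι => Ber(True, False, P k.swap) :=
    map_infinitePi_infinitePi_of_inj
      (P := fun k : ι × Fin 2 =>
        (toNNReal (P k) • dirac True + toNNReal (σ (P k)) • dirac False : Measure Prop))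
      Prod.swap_injective
  -- (2) curry
  have h2 : (infinitePi fun k : Fin 2 × ι => Ber(True, False, P k.swap)).map
      ⇑(MeasurableEquiv.curry (Fin 2) ι Prop) =
        infinitePi fun j : Fin 2 => infinitePi fun i : ι => Ber(True, False, P (i, j)) :=
    infinitePi_map_curry (fun (j : Fin 2) (i : ι) => Ber(True, False, P (i, j)))
  -- (3) the two layers are two distinct coordinates of the curried product
  have h3 : (infinitePi fun j : Fin 2 => infinitePi fun i : ι => Ber(True, False, P (i, j))).map
      (fun F : Fin 2 → ι → Prop => (F 0, F 1)) =
        (infinitePi fun i : ι => Ber(True, False, P (i, 0))).prod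
          (infinitePi fun i : ι => Ber(True, False, P (i, 1))) :=
    infinitePi_map_eval_prod
      (P := fun j : Fin 2 => infinitePi fun i : ι => Ber(True, False, P (i, j))) (by decide)
  -- the layer map factors through (1)–(3)
  have hcomp : (fun S : Set (ι × Fin 2) =>
      ({i | (i, (0 : Fin 2)) ∈ S}, {i | (i, (1 : Fin 2)) ∈ S})) ∘
        (fun q : ι × Fin 2 → Prop => {k | q k}) =
      ((Prod.map (fun q : ι → Prop => {i | q i}) (fun q : ι → Prop => {i | q i}) ∘
          (fun F : Fin 2 → ι → Prop => (F 0, F 1))) ∘ ⇑(MeasurableEquiv.curry (Fin 2) ι Prop)) ∘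
        (fun (ω : ι × Fin 2 → Prop) (k : Fin 2 × ι) => ω k.swap) := rfl
  rw [prodBernoulli_eq_map P, map_map measurable_layers measurable_setOf, hcomp,
    ← map_map (((hset.prodMap hset).comp hev).comp hcur) hsw, h1,
    ← map_map ((hset.prodMap hset).comp hev) hcur, h2,
    ← map_map (hset.prodMap hset) hev, h3,
    ← map_prod_map _ _ hset hset, prodBernoulli_eq_map, prodBernoulli_eq_map]
  rfl

/-- **The layers of the corner coins**: under `prodBernoulli (cornerParam t)` the coins
`{v | (v, 0) ∈ S}` and the splitting bits `{v | (v, 1) ∈ S}` are independent homogeneous product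
Bernoulli site configurations with parameters `1/2` and `half * t = t/2`. [folklore] -/
theorem prodBernoulli_cornerParam_map_layers (t : unitInterval) :
    (prodBernoulli (cornerParam t)).map (fun S : Set (Site 2 × Fin 2) =>
        ({v | (v, (0 : Fin 2)) ∈ S}, {v | (v, (1 : Fin 2)) ∈ S})) =
      (setBer((Set.univ : Set (Site 2)), half)).prod
        (setBer((Set.univ : Set (Site 2)), half * t)) := by
  rw [prodBernoulli_map_layers]
  simp only [cornerParam_apply_zero, cornerParam_apply_one, prodBernoulli_const]

/-- **The reflected corner configuration is the cell configuration of the reflected layers**: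
`-(cornerConfig S)` opens the left edge `s(m - e₀, m)` of `m` iff the coin of `-m` shows heads,
`(-m, 0) ∈ S`, and the down edge `s(m - e₁, m)` iff `((-m, 0) ∈ S ↔ (-m, 1) ∉ S)` (the east/north
edge `s(v, v + e_j)` of `v = -m` reflects to `s(m - e_j, m)`). [folklore] -/
theorem relabel_neg_cornerConfig (S : Set (Site 2 × Fin 2)) :
    BondConfig.relabel (sym2Equiv (Equiv.neg (Site 2))) (cornerConfig S) =
      {e | ∃ m : Site 2, ((-m, (0 : Fin 2)) ∈ S ∧ e = s(m - Pi.single 0 1, m)) ∨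
        (((-m, (0 : Fin 2)) ∈ S ↔ (-m, (1 : Fin 2)) ∉ S) ∧ e = s(m - Pi.single 1 1, m))} := by
  ext e
  rw [BondConfig.mem_relabel_iff, mem_cornerConfig_iff, Set.mem_setOf_eq]
  have key : ∀ v w : Site 2,
      (sym2Equiv (Equiv.neg (Site 2))).symm e = s(v, v + w) ↔ e = s(-v - w, -v) := by
    intro v w
    rw [Equiv.symm_apply_eq, sym2Equiv_mk, Equiv.neg_apply, neg_add', Sym2.eq_swap]
  simp only [key, vec10_eq_single, vec01_eq_single]
  constructor
  · rintro ⟨v, ⟨he, hv⟩ | ⟨he, hv⟩⟩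
    · exact ⟨-v, Or.inl ⟨by rwa [neg_neg], he⟩⟩
    · exact ⟨-v, Or.inr ⟨by rwa [neg_neg], he⟩⟩
  · rintro ⟨m, ⟨hm, he⟩ | ⟨hm, he⟩⟩
    · exact ⟨-m, Or.inl ⟨by rwa [neg_neg], hm⟩⟩
    · exact ⟨-m, Or.inr ⟨by rwa [neg_neg], hm⟩⟩

end CellLaw

/-! ### The stub -/

open MeasureTheory ProbabilityTheory
open Literature.Probability.Percolation Literature.Probability.LatticeModels
open Summit.CriticalPhenomena.CardyFormulaZ2.Theorems.BondIdent (measurable_cellMap)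

/-- **Stub `stub_cellLaw` of crux `SegmentRSW` (CELL LAW).** For `u ∈ [0, 1/2]` the cell measure
`μ_u` (the push-forward pinned by the crux, written out) IS the point reflection of the corner
model at `t = 2u`: `μ_u = (cornerPercolation ⟨2u⟩).map (relabel (x ↦ -x))`. Per vertex, the
(left, down) edges `s(m - e₀, m)`, `s(m - e₁, m)` of `m` are the images under `x ↦ -x` of the
(east, north) edges of `v = -m`, and both models open them as `(X, X ≠ D)` with `X` fair and
`D ~ Ber(u)`, `u = t/2` (`cornerParam t (v, 1) = half * t`), independently over the vertices:
`setBer(univ, 1/2) ⊗ setBer(univ, u)` is the pair of layers of `prodBernoulli (cornerParam ⟨2u⟩)`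
(`CellLaw.prodBernoulli_cornerParam_map_layers`), vertex reflection preserves that product measure
(`prodBernoulli_cornerParam_map_vertexReindex`), and the two configuration maps then agree
pointwise (`CellLaw.relabel_neg_cornerConfig`). [folklore] -/
theorem stub_cellLaw :
    ∀ u ∈ Set.Icc (0 : ℝ) (1 / 2),
      Measure.map
        (fun p : Set (Site 2) × Set (Site 2) ↦
          {e | ∃ m, (m ∈ p.1 ∧ e = s(m - Pi.single 0 1, m)) ∨
            ((m ∈ p.1 ↔ m ∉ p.2) ∧ e = s(m - Pi.single 1 1, m))})
        ((setBernoulli Set.univ half).prod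
          (setBernoulli Set.univ (Set.projIcc 0 1 zero_le_one u))) =
      (cornerPercolation (Set.projIcc 0 1 zero_le_one (2 * u))).map
        (BondConfig.relabel (sym2Equiv (Equiv.neg (Site 2)))) := by
  intro u hu
  -- the splitting parameter: `⟨u⟩ = half * ⟨2u⟩` in `[0, 1]`
  have hpar : Set.projIcc (0 : ℝ) 1 zero_le_one u =
      half * Set.projIcc (0 : ℝ) 1 zero_le_one (2 * u) := by
    refine Subtype.ext ?_
    rw [Set.Icc.coe_mul, coe_half,
      Set.projIcc_of_mem zero_le_one ⟨hu.1, hu.2.trans (by norm_num)⟩,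
      Set.projIcc_of_mem zero_le_one ⟨by linarith [hu.1], by linarith [hu.2]⟩]
    ring
  rw [hpar, ← CellLaw.prodBernoulli_cornerParam_map_layers,
    ← prodBernoulli_cornerParam_map_vertexReindex _ (Equiv.neg (Site 2)),
    Measure.map_map CellLaw.measurable_layers (measurable_vertexReindex _),
    Measure.map_map measurable_cellMap
      (CellLaw.measurable_layers.comp (measurable_vertexReindex _)),
    cornerPercolation_def,
    Measure.map_map (MeasurableEquiv.measurable _) measurable_cornerConfig]
  congr 1
  funext S
  exact (CellLaw.relabel_neg_cornerConfig S).symm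

end Summit.CriticalPhenomena.CardyFormulaZ2.Cruxes.SegmentRSW.Birth

end
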